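import Summits.QuantumFields.YangMills.Theorems.BalabanUVNodesN15BackwardShift
import HarnessLib

/-!
# N15 = NE2, road (c) — PROGRAMME (PC), (PC-E-J) GROUNDWORK: THE SHIFTED-ROW DEVICE — a DOUBLE-LOCALIZED row `1_S(y)1_S(y′)·βe^{−ρd}` survives the one-step shift `τ_e^*∘T` of an
# operator with an output plateau `χ` whose shifted support stays over `S` (`χ(ex) ≠ 0 → blk x ∈ S`), at the cost `e^{ρd₁}` of one block step (dag-n15-c g35, n15-c∕403; PCJ-DESIGN-g35.md §6 ⚠)

Cell `pub-ymgap`, seat `pub-ymgap-dag-n15-c` (generation g35; R134 (a) seat, strategy s1 «first missing estimate»; HUMAN RULING D-0062; chair R424 venue).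
`bears_on: R4∕N15 · K3⁸ SpineGivenEndpointR13SepCoPHV (stmt-QuantumFields-27366)`; filed `--kind proof --supports stmt-QuantumFields-27366 --as helper` — COUNT-NEUTRAL.
TWO theorems, 0 `def`, 0 `sorry`; [folklore] block-norm bookkeeping.  Imports BY NAME dag-n15-c g8 `…BackwardShift` (`hasMaj_pull_comp`; through it `B11SectG`, `T4EtaRateCoeffDefect.pull`,
`B6Prop26Gluing.mulOp∕ind`, `B11AxialTransport190.loc_ofBlocks_le`, `MatrixSpecies.liftBlk∕liftEquiv`).  Nothing in the tree is modified, no landed name re-declared.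

WHY.  n15-c∕400's rows `hSY` (the shifted row `τ_e^*∘Y`) and `hDS` (through `hasMaj_idef_shift_comp_of_rows`) for the dressed cubes `Y = X_□` must keep n15-c∕399's DOUBLE localization
`1_S(y)1_S(y′)`; `hasMaj_pull_comp` alone compares kernels pointwise and loses `1_S(y)` (the shifted block may leave `S`).  Device: insert the output plateau (`M_χ∘X = X`, n15-c∕334's
`mulOp_comp_smoothCutDressed`), move it through the shift (`τ_e^*∘M_χ = M_{χ∘e}∘τ_e^*`), shift the kernel without its output indicator (`hasMaj_pull_comp` + one block step `d₁` +
triangle), and re-insert `1_S(y)` from the support of `χ∘e`.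

CONTENTS.  §1 `hasMaj_loc_of_output_support` — `M_a∘T = T`, `a x ≠ 0 → blk x ∈ S`, `T ≤ K` ⟹ `T ≤ 1_S(y)·K`.  §2 ★★ `hasMaj_pull_shift_loc₂` — the device.

HONEST FRAMING ∕ LIMITS.  Generic bookkeeping; nothing of [B9] asserted; NE2⁺ NOT PRINTED ∕ NOT proved; N15 of record untouched (DISCHARGED AS CONSUMED, p687738); K3⁸ OPEN; counts of record
UNMOVED (typed 28∕28 · discharged 8∕27); one finite 𝕋⁴ at fixed ε per index — NOT infinite volume, NOT OS on ℝ⁴, NOT a mass gap, NOT Clay.  Restate-immune (no Theses import).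
-/

noncomputable section
open scoped BigOperators

namespace Summit.QuantumFields.YangMills.BalabanUVNodes.N15.Gluing

open Literature.MathematicalPhysics.QuantumFieldTheory.Balaban1983to89
open Literature.MathematicalPhysics.QuantumFieldTheory.Balaban1983to89.B11SectG (BlockNorm HasMaj)
open Literature.MathematicalPhysics.QuantumFieldTheory.Balaban1983to89.B6RandomWalk (Triangle254)
open Literature.MathematicalPhysics.QuantumFieldTheory.Balaban1983to89.T4EtaRateCoeffDefect (pull pull_apply)
open Literature.MathematicalPhysics.QuantumFieldTheory.Balaban1983to89.B6Prop26Gluing (mulOp mulOp_apply ind ind_nonneg ind_le_one)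
open Literature.MathematicalPhysics.QuantumFieldTheory.Balaban1983to89.B11AxialTransport190 (abs_le_loc_ofBlocks loc_ofBlocks_le)
open Summit.QuantumFields.YangMills.BalabanUVNodes.N15.MatrixSpecies (liftBlk liftEquiv liftEquiv_apply)
open Summit.QuantumFields.YangMills.BalabanUVNodes.N15.VectorPiece (hasMaj_pull_comp)

variable {X ι : Type} [Fintype X] [Fintype ι] {g : B6.Geometry} (blk : X → g.Site) {F₁ : Type} [AddCommGroup F₁] [Module ℝ F₁] {b₁ : BlockNorm g F₁}

/-- **OUTPUT LOCALIZATION FROM AN OUTPUT CUT**: `M_a∘T = T` with `a x ≠ 0 → blk x ∈ S` and `T ≤ K` ⟹ `T ≤ 1_S(y)·K(y, y′)`. [folklore] -/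
theorem hasMaj_loc_of_output_support {a : X → ℝ} {S : Set g.Site} {T : F₁ →ₗ[ℝ] (X × ι → ℝ)} {K : g.Site → g.Site → ℝ}
    (ha : mulOp (fun p : X × ι => a p.1) ∘ₗ T = T) (hS : ∀ x, a x ≠ 0 → blk x ∈ S)
    (hT : HasMaj b₁ (BlockNorm.ofBlocks g (liftBlk blk ι)) T K) :
    HasMaj b₁ (BlockNorm.ofBlocks g (liftBlk blk ι)) T (fun y y' => ind S y * K y y') := by
  classical
  intro y' μ hμ y
  show (BlockNorm.ofBlocks g (liftBlk blk ι)).loc y (T μ) ≤ ind S y * K y y' * b₁.loc y' μ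
  by_cases hy : y ∈ S
  · rw [show ind S y = 1 by simp [ind, hy], one_mul]; exact hT y' μ hμ y
  · rw [show ind S y = 0 by simp [ind, hy], zero_mul, zero_mul]
    refine loc_ofBlocks_le (liftBlk blk ι) _ le_rfl fun p hp => ?_
    have hx : a p.1 = 0 := by
      by_contra h
      exact hy (by rw [← hp]; exact hS p.1 h)
    rw [← ha, LinearMap.comp_apply, mulOp_apply, hx, zero_mul, abs_zero]

/-- ★★ **THE SHIFTED-ROW DEVICE**: output plateau `M_χ∘T = T`, shifted support `χ(ex) ≠ 0 → blk x ∈ S`, one block step `d(blk(ex), blk x) ≤ d₁`, triangle + symmetric distance, and the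
double-localized row `T ≤ 1_S1_S·βe^{−ρd}` (`β, ρ ≥ 0`) ⟹ `τ_e^*∘T ≤ 1_S1_S·(βe^{ρd₁})·e^{−ρd}`. [folklore] -/
theorem hasMaj_pull_shift_loc₂ (htri : Triangle254 g) (hsymm : ∀ y y', g.dist y y' = g.dist y' y) {χ : X → ℝ} {S : Set g.Site} {T : F₁ →ₗ[ℝ] (X × ι → ℝ)} (e : X ≃ X) {β ρ d₁ : ℝ}
    (hβ : 0 ≤ β) (hρ : 0 ≤ ρ) (hχ : mulOp (fun p : X × ι => χ p.1) ∘ₗ T = T) (hS : ∀ x, χ (e x) ≠ 0 → blk x ∈ S) (hstep : ∀ x, g.dist (blk (e x)) (blk x) ≤ d₁)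
    (hT : HasMaj b₁ (BlockNorm.ofBlocks g (liftBlk blk ι)) T (fun y y' => ind S y * ind S y' * (β * Real.exp (-(ρ * g.dist y y'))))) :
    HasMaj b₁ (BlockNorm.ofBlocks g (liftBlk blk ι)) (pull (liftEquiv e ι) ∘ₗ T) (fun y y' => ind S y * ind S y' * (β * Real.exp (ρ * d₁) * Real.exp (-(ρ * g.dist y y')))) := by
  -- insert the plateau and move it through the shift
  have hcomm : pull (liftEquiv e ι) ∘ₗ T = mulOp (fun p : X × ι => (χ ∘ e) p.1) ∘ₗ (pull (liftEquiv e ι) ∘ₗ T) := by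
    conv_lhs => rw [← hχ]
    refine LinearMap.ext fun f => funext fun p => ?_
    simp only [LinearMap.comp_apply, pull_apply, mulOp_apply, liftEquiv_apply, Function.comp_apply]
  -- shift the kernel WITHOUT its output indicator
  have h1 : HasMaj b₁ (BlockNorm.ofBlocks g (liftBlk blk ι)) (pull (liftEquiv e ι) ∘ₗ T) (fun y y' => ind S y' * (β * Real.exp (ρ * d₁) * Real.exp (-(ρ * g.dist y y')))) := by
    refine hasMaj_pull_comp (liftBlk blk ι) (liftEquiv e ι) (fun y y' => mul_nonneg (ind_nonneg _ _) (by positivity)) (fun p y' => ?_) hT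
    show ind S (blk (e p.1)) * ind S y' * (β * Real.exp (-(ρ * g.dist (blk (e p.1)) y'))) ≤ ind S y' * (β * Real.exp (ρ * d₁) * Real.exp (-(ρ * g.dist (blk p.1) y')))
    have hI := ind_le_one S (blk (e p.1))
    have hI0 := ind_nonneg S (blk (e p.1))
    have hd : g.dist (blk p.1) y' ≤ d₁ + g.dist (blk (e p.1)) y' := by
      have := htri (blk p.1) (blk (e p.1)) y'
      rw [hsymm (blk p.1) (blk (e p.1))] at this
      linarith [hstep p.1]
    have hexp : Real.exp (-(ρ * g.dist (blk (e p.1)) y')) ≤ Real.exp (ρ * d₁) * Real.exp (-(ρ * g.dist (blk p.1) y')) := by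
      rw [← Real.exp_add]
      exact Real.exp_le_exp.mpr (by nlinarith)
    calc ind S (blk (e p.1)) * ind S y' * (β * Real.exp (-(ρ * g.dist (blk (e p.1)) y')))
        ≤ 1 * ind S y' * (β * (Real.exp (ρ * d₁) * Real.exp (-(ρ * g.dist (blk p.1) y')))) :=
          mul_le_mul (mul_le_mul_of_nonneg_right hI (ind_nonneg _ _)) (mul_le_mul_of_nonneg_left hexp hβ) (mul_nonneg hβ (Real.exp_nonneg _)) (mul_nonneg zero_le_one (ind_nonneg _ _))
      _ = _ := by ring
  refine (hasMaj_loc_of_output_support blk (a := χ ∘ ⇑e) hcomm.symm (fun x hx => hS x hx) h1).mono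
    fun y y' => le_of_eq ?_
  ring

end Summit.QuantumFields.YangMills.BalabanUVNodes.N15.Gluing

end
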